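import Summits.CriticalPhenomena.PercolationContinuityZ3.Theorems.Transplant.FKConnectivityAllQAntipodalAndStar3Contracted
import Summits.CriticalPhenomena.PercolationContinuityZ3.Theorems.Transplant.FKConnectivityAllQAntipodalAndStar3Series
import Summits.CriticalPhenomena.PercolationContinuityZ3.Theorems.Transplant.FKConnectivityAllQAntipodalAnd4Star
import Summits.CriticalPhenomena.PercolationContinuityZ3.Theorems.Transplant.FKConnectivityAllQAntipodalAndStar3Erase
import HarnessLib

/-!
# Connectivity correlation inequalities for `φ_{w,q}`, every `q > 0` — file 31b: **`C_∞(and)` AT LEVEL 3 FOR THE 3-STAR `K₁,₃` ON EVERY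
# 2-CONNECTED SERIES–PARALLEL GRAPH** (induction on the number of edges of `H \ ob`, assembling the star–series, parallel and R-extension theorems)

Support file (`--supports stmt-CriticalPhenomena-4575`), FK sub-lane `prim-bschramm-fk-2` (gen 19) of the post-continuity programme; builds
on p205010 (kernel theorem, internal audit signed; external expert review pending).  No definitions, no named facts, no sorries; standard axioms.

THE RESULT.  Let `K` be a two-terminal series–parallel network between `o` and `b` containing two distinct edges `ao`, `oc` at `o` and not the edge
`ob`, and `H = K ∪ {ob}` (an arbitrary 2-connected series–parallel graph presented from its edge `ob`; `S = {ao, ob, oc}` an arbitrary 3-star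
centred at `o`).  Then for every `0 < q ≤ 1` and every increasing `g` on the other edges: `apPsi q H 1_{S ⊆ ·} g ≤ 0`
(**`FK.apPsi_and_star3_nonpos_of_isTTSP`**): every square-free coefficient of `Z_H² Cov_{φ_{z,q}}(ω_{ao} ω_{ob} ω_{oc}, g)` is `≤ 0` — gen 10's
Conjecture `C_∞` for the AND type on a 3-star.  With file 30a (the 3-edge path) and gen 17's triangle this closes level 3 of `C_∞` for every
CONNECTED 3-edge `S` on series–parallel graphs.  PROOF (`and_star3_drift_nonpos_of_isTTSP`, strong induction on `|K|`, then cases on the last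
constructor of `K`): a SERIES root `K = E₁(o,m) · E₂(m,b)` forces `ao, oc ∈ E₁` and is file 31's star–series junction, whose recursive input —
the star `{ao, om, oc}` on `E₁` rooted at the VIRTUAL edge `om` — is the induction hypothesis for `E₁` when `om ∉ E₁`, the pair theorem when
`om ∈ {ao, oc}`, and file 31a's doubled-root lemma (induction hypothesis for `E₁ \ om`, TTSP by `IsTTSP.erase_terminal_edge`) when `om ∈ E₁`;
a PARALLEL root with `ao`, `oc` in different parts is file 28's junction (as in file 28b: the AND functional sees only the vertex partition, so the
star is the path `a–o–b–c`); in one part `F` it is file 29's R-extension theorem for the path `a–o–b–c` (junction pair `{o, b}`) with the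
induction hypothesis for `F`, file 31a's `ob`-contracted star drift, and Theorem U on the other part.
[cite: Grimmett2006, §1.4 eq. (1.20) (p. 15); §3.8 Thm. (3.90) (pp. 61–62); §3.9 (pp. 63–64)] [cite: Wagner2006, Thm. 5.8(d), §5.3]
-/

noncomputable section

namespace Summit.CriticalPhenomena.PercolationContinuityZ3.Theorems

namespace FK

open SimpleGraph Literature.Probability.LatticeModels Literature.Probability.Percolation
open scoped Classical

variable {V : Type*} [Fintype V]

/-! ### The induction -/

section StarPath

/-- **THE INDUCTION (AND-drift form, 3-star).**  For every two-terminal series–parallel `K` between `o, b` with distinct edges `ao, oc ∈ K`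
and `ob ∉ K`, and every `h` monotone on the subsets of `N = K \ {ao, oc}` (`0 < q ≤ 1`):
`∑_{γ ⊆ N} (q^{k(γ ∪ S) + k(N \ γ)} - q^{k((N \ γ) ∪ S) + k(γ)}) h(γ) ≤ 0`, `S = {ao, ob, oc}` — strong induction on `|K|` (the bound `n`), cases on
the root of `K`: series ⇒ `and_star3_series_nonpos` with the induction hypothesis through the virtual root edge (`and_star3_side_of_mem` /
`IsTTSP.erase_terminal_edge` when it doubles a real edge, `and_pair_side_nonpos` when it coincides with a star edge); parallel, different parts
⇒ `and4_parallel_nonpos` (star = path); parallel, one part ⇒ `and4_theta_nonpos` with the induction hypothesis and `andc_star_side_nonpos`.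
[cite: Grimmett2006, §3.8 Thm. (3.90) (pp. 61–62); §3.9 (pp. 63–64)] [cite: Wagner2006, Thm. 5.8(d), §5.3] -/
theorem and_star3_drift_nonpos_of_isTTSP {q : ℝ} (hq0 : 0 < q) (hq1 : q ≤ 1) :
    ∀ (n : ℕ) {K : Finset (Sym2 V)} {o b a c : V}, K.card ≤ n → IsTTSP K o b →
      s(a, o) ∈ K → s(o, c) ∈ K → s(a, o) ≠ s(o, c) → s(o, b) ∉ K →
      ∀ h : Finset (Sym2 V) → ℝ, (∀ ⦃A B : Finset (Sym2 V)⦄, A ⊆ B → B ⊆ (K.erase s(a, o)).erase s(o, c) → h A ≤ h B) →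
        ∑ γ ∈ ((K.erase s(a, o)).erase s(o, c)).powerset,
          (q ^ (clusterCount (↑(γ ∪ {s(a, o), s(o, b), s(o, c)}) : BondConfig V) ∅ +
                clusterCount (↑((K.erase s(a, o)).erase s(o, c) \ γ) : BondConfig V) ∅) -
            q ^ (clusterCount (↑((K.erase s(a, o)).erase s(o, c) \ γ ∪ {s(a, o), s(o, b), s(o, c)}) : BondConfig V) ∅ +
                clusterCount (↑γ : BondConfig V) ∅)) * h γ ≤ 0 := by
  intro n
  induction n with
  | zero =>
    intro K o b a c hcard _ hao _ _ _ _ _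
    rw [Nat.le_zero, Finset.card_eq_zero] at hcard
    rw [hcard] at hao
    exact absurd hao (Finset.notMem_empty _)
  | succ n ih =>
    intro K o b a c hcard hK hao hoc hne hob h hmono
    cases hK with
    | edge hob' => exact absurd (Finset.mem_singleton_self _) hob
    | @series E₁ E₂ _ m _ h₁ h₂ hd hV ho' hb' =>
      -- the star edges sit in `E₁`
      have hao₂ : s(a, o) ∉ E₂ := fun h' => ho' _ h' (Sym2.mem_mk_right a o)
      have hoc₂ : s(o, c) ∉ E₂ := fun h' => ho' _ h' (Sym2.mem_mk_left o c)
      have hao₁ : s(a, o) ∈ E₁ := (Finset.mem_union.1 hao).resolve_right hao₂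
      have hoc₁ : s(o, c) ∈ E₁ := (Finset.mem_union.1 hoc).resolve_right hoc₂
      have hob₁ : s(o, m) ∈ E₁ ∨ s(o, m) ∉ E₁ := em _
      have hN : ((E₁ ∪ E₂).erase s(a, o)).erase s(o, c) = (E₁.erase s(a, o)).erase s(o, c) ∪ E₂ := by
        rw [erase_union_of_notMem_right hao₂, erase_union_of_notMem_right hoc₂]
      rw [hN] at hmono ⊢
      set N₁ := (E₁.erase s(a, o)).erase s(o, c) with hN₁
      have hoc₁' : s(o, c) ∈ E₁.erase s(a, o) := Finset.mem_erase.2 ⟨fun hh => hne hh.symm, hoc₁⟩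
      have hKE : insert s(a, o) (insert s(o, c) N₁) = E₁ := by
        rw [hN₁, Finset.insert_erase hoc₁', Finset.insert_erase hao₁]
      have hK₁ : IsTTSP (insert s(a, o) (insert s(o, c) N₁)) o m := by rw [hKE]; exact h₁
      have haoN : s(a, o) ∉ N₁ := fun hh => Finset.notMem_erase _ _ (Finset.mem_of_mem_erase hh)
      have hocN : s(o, c) ∉ N₁ := Finset.notMem_erase _ _
      -- distinctness, vertex sets, cardinalities
      have hom : o ≠ m := h₁.ne
      have hbm : b ≠ m := h₂.ne.symm
      have hob' : o ≠ b := by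
        obtain ⟨e, he, hbe⟩ := h₂.right_mem
        intro hh; exact ho' e he (hh ▸ hbe)
      set V₁ : Set V := {z | ∃ e ∈ E₁, z ∈ e} with hV₁
      set V₂ : Set V := {z | ∃ e ∈ E₂, z ∈ e} with hV₂
      have g₁ : ∀ e ∈ (↑E₁ : Set (Sym2 V)), ∀ z ∈ e, z ∈ V₁ := fun e he z hz => ⟨e, he, hz⟩
      have g₂ : ∀ e ∈ (↑E₂ : Set (Sym2 V)), ∀ z ∈ e, z ∈ V₂ := fun e he z hz => ⟨e, he, hz⟩
      have hS : V₁ ∩ V₂ ⊆ ({m} : Set V) := fun z hz => hV z hz.1 hz.2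
      have hoV₂ : o ∉ V₂ := fun ⟨e, he, hoe⟩ => ho' e he hoe
      have hbV₁ : b ∉ V₁ := fun ⟨e, he, hbe⟩ => hb' e he hbe
      have hdN : Disjoint N₁ E₂ := Finset.disjoint_of_subset_left ((Finset.erase_subset _ _).trans (Finset.erase_subset _ _)) hd
      have hcard₁ : E₁.card ≤ n := by
        have hc := Finset.card_union_of_disjoint hd
        obtain ⟨e, he, _⟩ := h₂.left_mem
        have h2pos : 0 < E₂.card := Finset.card_pos.2 ⟨e, he⟩
        omega
      -- the recursive input: the smaller star `{ao, om, oc}` on `N₁`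
      have hZ₁ : ∀ h' : Finset (Sym2 V) → ℝ, (∀ ⦃A B : Finset (Sym2 V)⦄, A ⊆ B → B ⊆ N₁ → h' A ≤ h' B) →
          ∑ γ₁ ∈ N₁.powerset, (q ^ (clusterCount (↑(γ₁ ∪ {s(a, o), s(o, m), s(o, c)}) : BondConfig V) ∅ +
              clusterCount (↑(N₁ \ γ₁) : BondConfig V) ∅) -
            q ^ (clusterCount (↑(N₁ \ γ₁ ∪ {s(a, o), s(o, m), s(o, c)}) : BondConfig V) ∅ + clusterCount (↑γ₁ : BondConfig V) ∅)) *
              h' γ₁ ≤ 0 := by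
        intro h' hm
        by_cases hma : s(o, m) = s(a, o)
        · simp_rw [star3_triple_eq_pair_left hma]
          exact and_pair_side_nonpos hq0 hq1 hK₁ haoN hocN hne hm
        by_cases hmc : s(o, m) = s(o, c)
        · simp_rw [star3_triple_eq_pair_right hmc]
          exact and_pair_side_nonpos hq0 hq1 hK₁ haoN hocN hne hm
        by_cases homE : s(o, m) ∈ E₁
        · -- the virtual root edge doubles a real one: recurse on `E₁ \ om`
          have homN : s(o, m) ∈ N₁ := Finset.mem_erase.2 ⟨hmc, Finset.mem_erase.2 ⟨hma, homE⟩⟩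
          refine and_star3_side_of_mem hq0 hq1 hK₁ haoN hocN hne homN ?_ hm
          intro h'' hm''
          have hE' : IsTTSP (E₁.erase s(o, m)) o m :=
            h₁.erase_terminal_edge homE (fun hh => by rw [hh, Finset.mem_singleton] at hao₁; exact hma hao₁.symm)
          have hN' : ((E₁.erase s(o, m)).erase s(a, o)).erase s(o, c) = N₁.erase s(o, m) := by
            rw [hN₁, Finset.erase_right_comm (a := s(o, m)), Finset.erase_right_comm (a := s(o, m))]
          have key := ih (K := E₁.erase s(o, m)) (le_trans (Finset.card_erase_le) hcard₁) hE'
            (Finset.mem_erase.2 ⟨fun hh => hma hh.symm, hao₁⟩) (Finset.mem_erase.2 ⟨fun hh => hmc hh.symm, hoc₁⟩) hne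
            (Finset.notMem_erase _ _) h'' (by rw [hN']; exact hm'')
          rw [hN'] at key
          exact key
        · exact ih (le_trans le_rfl hcard₁) h₁ hao₁ hoc₁ hne homE h' hm
      have hY₁ : ∀ h' : Finset (Sym2 V) → ℝ, (∀ ⦃A B : Finset (Sym2 V)⦄, A ⊆ B → B ⊆ N₁ → h' A ≤ h' B) →
          ∑ γ₁ ∈ N₁.powerset, (q ^ (clusterCount (↑(γ₁ ∪ {s(a, o), s(o, c)}) : BondConfig V) ∅ + clusterCount (↑(N₁ \ γ₁) : BondConfig V) ∅) -
            q ^ (clusterCount (↑(N₁ \ γ₁ ∪ {s(a, o), s(o, c)}) : BondConfig V) ∅ + clusterCount (↑γ₁ : BondConfig V) ∅)) * h' γ₁ ≤ 0 :=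
        fun h' hm => and_pair_side_nonpos hq0 hq1 hK₁ haoN hocN hne hm
      have hU₂ : ∀ h' : Finset (Sym2 V) → ℝ, (∀ ⦃A B : Finset (Sym2 V)⦄, A ⊆ B → B ⊆ E₂ → h' A ≤ h' B) → 0 ≤ apUpc q E₂ m b h' :=
        fun h' hm => apUpc_nonneg_of_isTTSP hq0 h₂ E₂ le_rfl h' hm
      exact and_star3_series_nonpos hq0 hq1 g₁ g₂ hS hoV₂ hbV₁ hom hbm hob' hao₁ hoc₁ hdN
        ((Finset.erase_subset _ _).trans (Finset.erase_subset _ _)) le_rfl hZ₁ hY₁ hU₂ hmono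
    | @parallel E₁ E₂ _ _ h₁ h₂ hd hV =>
      have hobne : o ≠ b := h₁.ne
      have hob₁ : s(o, b) ∉ E₁ := fun h' => hob (Finset.mem_union_left _ h')
      have hob₂ : s(o, b) ∉ E₂ := fun h' => hob (Finset.mem_union_right _ h')
      set V₁ : Set V := {z | ∃ e ∈ E₁, z ∈ e} with hV₁
      set V₂ : Set V := {z | ∃ e ∈ E₂, z ∈ e} with hV₂
      have g₁ : ∀ e ∈ (↑E₁ : Set (Sym2 V)), ∀ z ∈ e, z ∈ V₁ := fun e he z hz => ⟨e, he, hz⟩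
      have g₂ : ∀ e ∈ (↑E₂ : Set (Sym2 V)), ∀ z ∈ e, z ∈ V₂ := fun e he z hz => ⟨e, he, hz⟩
      have hS : V₁ ∩ V₂ ⊆ ({o, b} : Set V) := by
        intro z hz
        rcases hV z hz.1 hz.2 with h' | h'
        · exact Or.inl h'
        · exact Or.inr h'
      have hS' : V₂ ∩ V₁ ⊆ ({o, b} : Set V) := fun z hz => hS ⟨hz.2, hz.1⟩
      have hc := Finset.card_union_of_disjoint hd
      have hcard₁ : E₁.card ≤ n := by
        obtain ⟨e, he, _⟩ := h₂.left_mem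
        have h2pos : 0 < E₂.card := Finset.card_pos.2 ⟨e, he⟩
        omega
      have hcard₂ : E₂.card ≤ n := by
        obtain ⟨e, he, _⟩ := h₁.left_mem
        have h1pos : 0 < E₁.card := Finset.card_pos.2 ⟨e, he⟩
        omega
      -- star = path for the AND functional
      have conv : ∀ (M : Finset (Sym2 V)) (h' : Finset (Sym2 V) → ℝ),
          ∑ γ ∈ M.powerset, (q ^ (clusterCount (↑(γ ∪ {s(a, o), s(o, b), s(o, c)}) : BondConfig V) ∅ + clusterCount (↑(M \ γ) : BondConfig V) ∅) -
            q ^ (clusterCount (↑(M \ γ ∪ {s(a, o), s(o, b), s(o, c)}) : BondConfig V) ∅ + clusterCount (↑γ : BondConfig V) ∅)) * h' γ =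
          ∑ γ ∈ M.powerset, (q ^ (clusterCount (↑(γ ∪ {s(a, o), s(o, b), s(b, c)}) : BondConfig V) ∅ + clusterCount (↑(M \ γ) : BondConfig V) ∅) -
            q ^ (clusterCount (↑(M \ γ ∪ {s(a, o), s(o, b), s(b, c)}) : BondConfig V) ∅ + clusterCount (↑γ : BondConfig V) ∅)) * h' γ := by
        intro M h'
        refine Finset.sum_congr rfl fun γ _ => ?_
        rw [clusterCount_union_star3_eq γ a c hobne, clusterCount_union_star3_eq (M \ γ) a c hobne]
      -- the theta case, for either part: R-extension for the path `a–o–b–c` at the pair `{o, b}`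
      have theta : ∀ {F R : Finset (Sym2 V)} {W₁ W₂ : Set V}, IsTTSP F o b → IsTTSP R o b → Disjoint F R → F.card ≤ n →
          (∀ e ∈ (↑F : Set (Sym2 V)), ∀ z ∈ e, z ∈ W₁) → (∀ e ∈ (↑R : Set (Sym2 V)), ∀ z ∈ e, z ∈ W₂) → W₁ ∩ W₂ ⊆ ({o, b} : Set V) →
          s(a, o) ∈ F → s(o, c) ∈ F → s(o, b) ∉ F →
          ∀ h' : Finset (Sym2 V) → ℝ, (∀ ⦃A B : Finset (Sym2 V)⦄, A ⊆ B → B ⊆ (F.erase s(a, o)).erase s(o, c) ∪ R → h' A ≤ h' B) →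
            ∑ γ ∈ ((F.erase s(a, o)).erase s(o, c) ∪ R).powerset,
              (q ^ (clusterCount (↑(γ ∪ {s(a, o), s(o, b), s(o, c)}) : BondConfig V) ∅ +
                    clusterCount (↑(((F.erase s(a, o)).erase s(o, c) ∪ R) \ γ) : BondConfig V) ∅) -
                q ^ (clusterCount (↑(((F.erase s(a, o)).erase s(o, c) ∪ R) \ γ ∪ {s(a, o), s(o, b), s(o, c)}) : BondConfig V) ∅ +
                    clusterCount (↑γ : BondConfig V) ∅)) * h' γ ≤ 0 := by
        intro F R W₁ W₂ hF hR hdFR hcardF k₁ k₂ kS haoF hocF hobF h' hm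
        set M := (F.erase s(a, o)).erase s(o, c) with hM
        have hocF' : s(o, c) ∈ F.erase s(a, o) := Finset.mem_erase.2 ⟨fun hh => hne hh.symm, hocF⟩
        have hKM : insert s(a, o) (insert s(o, c) M) = F := by
          rw [hM, Finset.insert_erase hocF', Finset.insert_erase haoF]
        have hKF : IsTTSP (insert s(a, o) (insert s(o, c) M)) o b := by rw [hKM]; exact hF
        have haoM : s(a, o) ∉ M := fun hh => Finset.notMem_erase _ _ (Finset.mem_of_mem_erase hh)
        have hocM : s(o, c) ∉ M := Finset.notMem_erase _ _
        have hobKM : s(o, b) ∉ insert s(a, o) (insert s(o, c) M) := by rw [hKM]; exact hobF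
        have hMF : M ⊆ F := (Finset.erase_subset _ _).trans (Finset.erase_subset _ _)
        have hcF : c ∈ W₁ := k₁ _ hocF c (Sym2.mem_mk_right o c)
        -- ambient set of the `M`-side for the path `a–o–b–c`: `F ∪ {ob, bc}`
        set W₁' : Set V := {z | ∃ e ∈ insert s(b, c) (insert s(o, b) F), z ∈ e} with hW₁'
        have k₁' : ∀ e ∈ (↑(insert s(b, c) (insert s(o, b) F)) : Set (Sym2 V)), ∀ z ∈ e, z ∈ W₁' := fun e he z hz => ⟨e, he, hz⟩
        have kS' : W₁' ∩ W₂ ⊆ ({o, b} : Set V) := by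
          rintro z ⟨⟨e, he, hze⟩, hz₂⟩
          rcases Finset.mem_insert.1 he with rfl | he
          · rcases Sym2.mem_iff.1 hze with rfl | rfl
            · exact Or.inr rfl
            · exact kS ⟨hcF, hz₂⟩
          · rcases Finset.mem_insert.1 he with rfl | he
            · rcases Sym2.mem_iff.1 hze with rfl | rfl
              · exact Or.inl rfl
              · exact Or.inr rfl
            · exact kS ⟨k₁ e he z hze, hz₂⟩
        have kSE : ({s(a, o), s(o, b), s(b, c)} : Finset (Sym2 V)) ⊆ insert s(b, c) (insert s(o, b) F) := by
          intro e he
          simp only [Finset.mem_insert, Finset.mem_singleton] at he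
          rcases he with rfl | rfl | rfl
          · exact Finset.mem_insert_of_mem (Finset.mem_insert_of_mem haoF)
          · exact Finset.mem_insert_of_mem (Finset.mem_insert_self _ _)
          · exact Finset.mem_insert_self _ _
        have hdMR : Disjoint M R := Finset.disjoint_of_subset_left hMF hdFR
        -- the three inputs of the R-extension theorem, for the path `a–o–b–c`
        have hA : ∀ h'' : Finset (Sym2 V) → ℝ, (∀ ⦃A B : Finset (Sym2 V)⦄, A ⊆ B → B ⊆ M → h'' A ≤ h'' B) →
            ∑ γ ∈ M.powerset, (q ^ (clusterCount (↑(γ ∪ {s(a, o), s(o, b), s(b, c)}) : BondConfig V) ∅ + clusterCount (↑(M \ γ) : BondConfig V) ∅) -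
              q ^ (clusterCount (↑(M \ γ ∪ {s(a, o), s(o, b), s(b, c)}) : BondConfig V) ∅ + clusterCount (↑γ : BondConfig V) ∅)) * h'' γ ≤ 0 := by
          intro h'' hm''
          rw [← conv M h'']
          exact ih hcardF hF haoF hocF hne hobF h'' hm''
        have hAc : ∀ h'' : Finset (Sym2 V) → ℝ, (∀ ⦃A B : Finset (Sym2 V)⦄, A ⊆ B → B ⊆ M → h'' A ≤ h'' B) →
            ∑ γ ∈ M.powerset, (q ^ (clusterCount (↑(γ ∪ {s(a, o), s(o, b), s(b, c)}) : BondConfig V) ∅ +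
                  clusterCount (↑(M \ γ ∪ {s(o, b)}) : BondConfig V) ∅) -
              q ^ (clusterCount (↑(M \ γ ∪ {s(a, o), s(o, b), s(b, c)}) : BondConfig V) ∅ +
                  clusterCount (↑(γ ∪ {s(o, b)}) : BondConfig V) ∅)) * h'' γ ≤ 0 := by
          intro h'' hm''
          have key := andc_star_side_nonpos hq0 hq1 hKF haoM hocM hne hobKM hm''
          have hsum : ∑ γ ∈ M.powerset, (q ^ (clusterCount (↑(γ ∪ {s(a, o), s(o, b), s(b, c)}) : BondConfig V) ∅ +
                  clusterCount (↑(M \ γ ∪ {s(o, b)}) : BondConfig V) ∅) -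
              q ^ (clusterCount (↑(M \ γ ∪ {s(a, o), s(o, b), s(b, c)}) : BondConfig V) ∅ +
                  clusterCount (↑(γ ∪ {s(o, b)}) : BondConfig V) ∅)) * h'' γ =
              ∑ γ ∈ M.powerset, (q ^ (clusterCount (↑(γ ∪ {s(a, o), s(o, b), s(o, c)}) : BondConfig V) ∅ +
                  clusterCount (↑(M \ γ ∪ {s(o, b)}) : BondConfig V) ∅) -
              q ^ (clusterCount (↑(M \ γ ∪ {s(a, o), s(o, b), s(o, c)}) : BondConfig V) ∅ +
                  clusterCount (↑(γ ∪ {s(o, b)}) : BondConfig V) ∅)) * h'' γ := by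
            refine Finset.sum_congr rfl fun γ _ => ?_
            rw [clusterCount_union_star3_eq γ a c hobne, clusterCount_union_star3_eq (M \ γ) a c hobne]
          rw [hsum]; exact key
        have hU : ∀ h'' : Finset (Sym2 V) → ℝ, (∀ ⦃A B : Finset (Sym2 V)⦄, A ⊆ B → B ⊆ R → h'' A ≤ h'' B) → 0 ≤ apUpc q R o b h'' :=
          fun h'' hm'' => apUpc_nonneg_of_isTTSP hq0 hR R le_rfl h'' hm''
        rw [conv (M ∪ R) h']
        exact and4_theta_nonpos hq0 hq1 k₁' k₂ kS' hobne kSE hdMR (hMF.trans ((Finset.subset_insert _ _).trans (Finset.subset_insert _ _)))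
          le_rfl hA hAc hU hm
      -- the parallel case, for either orientation: the path `a–o–b–c` across the pair `{o, b}`
      have par : ∀ {F₁ F₂ : Finset (Sym2 V)} {W₁ W₂ : Set V}, IsTTSP F₁ o b → IsTTSP F₂ o b → Disjoint F₁ F₂ →
          (∀ e ∈ (↑F₁ : Set (Sym2 V)), ∀ z ∈ e, z ∈ W₁) → (∀ e ∈ (↑F₂ : Set (Sym2 V)), ∀ z ∈ e, z ∈ W₂) → W₁ ∩ W₂ ⊆ ({o, b} : Set V) →
          s(a, o) ∈ F₁ → s(o, c) ∈ F₂ → s(o, b) ∉ F₁ → s(o, b) ∉ F₂ →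
          ∀ h' : Finset (Sym2 V) → ℝ, (∀ ⦃A B : Finset (Sym2 V)⦄, A ⊆ B → B ⊆ F₁.erase s(a, o) ∪ F₂.erase s(o, c) → h' A ≤ h' B) →
            ∑ γ ∈ (F₁.erase s(a, o) ∪ F₂.erase s(o, c)).powerset,
              (q ^ (clusterCount (↑(γ ∪ {s(a, o), s(o, b), s(o, c)}) : BondConfig V) ∅ +
                    clusterCount (↑((F₁.erase s(a, o) ∪ F₂.erase s(o, c)) \ γ) : BondConfig V) ∅) -
                q ^ (clusterCount (↑((F₁.erase s(a, o) ∪ F₂.erase s(o, c)) \ γ ∪ {s(a, o), s(o, b), s(o, c)}) : BondConfig V) ∅ +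
                    clusterCount (↑γ : BondConfig V) ∅)) * h' γ ≤ 0 := by
        intro F₁ F₂ W₁ W₂ hF₁ hF₂ hd₁₂ k₁ k₂ kS haoF hocF hobF₁ hobF₂ h' hm
        set N₁ := F₁.erase s(a, o) with hN₁
        set N₂ := F₂.erase s(o, c) with hN₂
        have hA₁ : IsTTSP (insert s(a, o) N₁) o b := by rw [hN₁, Finset.insert_erase haoF]; exact hF₁
        have hA₂ : IsTTSP (insert s(o, c) N₂) o b := by rw [hN₂, Finset.insert_erase hocF]; exact hF₂
        have hobA₁ : s(o, b) ∉ insert s(a, o) N₁ := by rw [hN₁, Finset.insert_erase haoF]; exact hobF₁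
        have hobA₂ : s(o, b) ∉ insert s(o, c) N₂ := by rw [hN₂, Finset.insert_erase hocF]; exact hobF₂
        have hn₁ : s(a, o) ∉ N₁ := Finset.notMem_erase _ _
        have hn₂ : s(o, c) ∉ N₂ := Finset.notMem_erase _ _
        have hdN : Disjoint N₁ N₂ :=
          Finset.disjoint_of_subset_left (Finset.erase_subset _ _) (Finset.disjoint_of_subset_right (Finset.erase_subset _ _) hd₁₂)
        have hcF : c ∈ W₂ := k₂ _ hocF c (Sym2.mem_mk_right o c)
        -- side 2 enlarged by the virtual end edge `bc` of the path
        set W₂' : Set V := {z | ∃ e ∈ insert s(b, c) F₂, z ∈ e} with hW₂'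
        have k₂' : ∀ e ∈ (↑(insert s(b, c) F₂) : Set (Sym2 V)), ∀ z ∈ e, z ∈ W₂' := fun e he z hz => ⟨e, he, hz⟩
        have kS' : W₁ ∩ W₂' ⊆ ({o, b} : Set V) := by
          rintro z ⟨hz₁, ⟨e, he, hze⟩⟩
          rcases Finset.mem_insert.1 he with rfl | he
          · rcases Sym2.mem_iff.1 hze with rfl | rfl
            · exact Or.inr rfl
            · exact kS ⟨hz₁, hcF⟩
          · exact kS ⟨hz₁, k₂ e he z hze⟩
        have hY₁ : ∀ h'' : Finset (Sym2 V) → ℝ, (∀ ⦃A B : Finset (Sym2 V)⦄, A ⊆ B → B ⊆ N₁ → h'' A ≤ h'' B) →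
            ∑ γ₁ ∈ N₁.powerset, (q ^ (clusterCount (↑(insert s(o, b) (insert s(a, o) γ₁)) : BondConfig V) ∅ +
                clusterCount (↑(N₁ \ γ₁) : BondConfig V) ∅) -
              q ^ (clusterCount (↑(insert s(o, b) (insert s(a, o) (N₁ \ γ₁))) : BondConfig V) ∅ +
                clusterCount (↑γ₁ : BondConfig V) ∅)) * h'' γ₁ ≤ 0 := by
          intro h'' hm''
          have key := and2_side_nonpos hq0 hq1 hA₁ hobA₁ (Finset.mem_insert_self _ _) (h := h'')
            (by rw [Finset.erase_insert hn₁]; exact hm'')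
          rwa [Finset.erase_insert hn₁] at key
        have hΞ₁ : ∀ h'' : Finset (Sym2 V) → ℝ, (∀ ⦃A B : Finset (Sym2 V)⦄, A ⊆ B → B ⊆ N₁ → h'' A ≤ h'' B) →
            0 ≤ apUpcC q N₁ {s(o, b)} a o h'' := by
          intro h'' hm''
          have key := xi_side_nonneg hq0 hA₁ hobA₁ (Finset.mem_insert_self _ _) (h := h'')
            (by rw [Finset.erase_insert hn₁]; exact hm'')
          rwa [Finset.erase_insert hn₁] at key
        have hY₂ : ∀ h'' : Finset (Sym2 V) → ℝ, (∀ ⦃A B : Finset (Sym2 V)⦄, A ⊆ B → B ⊆ N₂ → h'' A ≤ h'' B) →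
            ∑ γ₂ ∈ N₂.powerset, (q ^ (clusterCount (↑(insert s(o, b) (insert s(b, c) γ₂)) : BondConfig V) ∅ +
                clusterCount (↑(N₂ \ γ₂) : BondConfig V) ∅) -
              q ^ (clusterCount (↑(insert s(o, b) (insert s(b, c) (N₂ \ γ₂))) : BondConfig V) ∅ +
                clusterCount (↑γ₂ : BondConfig V) ∅)) * h'' γ₂ ≤ 0 := by
          intro h'' hm''
          have key := and2_side_nonpos hq0 hq1 hA₂ hobA₂ (Finset.mem_insert_self _ _) (h := h'')
            (by rw [Finset.erase_insert hn₂]; exact hm'')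
          rw [Finset.erase_insert hn₂] at key
          have hsum : ∑ γ₂ ∈ N₂.powerset, (q ^ (clusterCount (↑(insert s(o, b) (insert s(b, c) γ₂)) : BondConfig V) ∅ +
                clusterCount (↑(N₂ \ γ₂) : BondConfig V) ∅) -
              q ^ (clusterCount (↑(insert s(o, b) (insert s(b, c) (N₂ \ γ₂))) : BondConfig V) ∅ +
                clusterCount (↑γ₂ : BondConfig V) ∅)) * h'' γ₂ =
              ∑ γ₂ ∈ N₂.powerset, (q ^ (clusterCount (↑(insert s(o, b) (insert s(o, c) γ₂)) : BondConfig V) ∅ +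
                clusterCount (↑(N₂ \ γ₂) : BondConfig V) ∅) -
              q ^ (clusterCount (↑(insert s(o, b) (insert s(o, c) (N₂ \ γ₂))) : BondConfig V) ∅ +
                clusterCount (↑γ₂ : BondConfig V) ∅)) * h'' γ₂ := by
            refine Finset.sum_congr rfl fun γ₂ _ => ?_
            rw [clusterCount_insert_insert_hub_eq γ₂ c hobne, clusterCount_insert_insert_hub_eq (N₂ \ γ₂) c hobne]
          rw [hsum]; exact key
        have hΞ₂ : ∀ h'' : Finset (Sym2 V) → ℝ, (∀ ⦃A B : Finset (Sym2 V)⦄, A ⊆ B → B ⊆ N₂ → h'' A ≤ h'' B) →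
            0 ≤ apUpcC q N₂ {s(o, b)} b c h'' := by
          intro h'' hm''
          have key := xi_side_nonneg hq0 hA₂ hobA₂ (Finset.mem_insert_self _ _) (h := h'')
            (by rw [Finset.erase_insert hn₂]; exact hm'')
          rw [Finset.erase_insert hn₂, apUpcC_contract_terminal_eq q N₂ c hobne h''] at key
          exact key
        rw [conv (N₁ ∪ N₂) h']
        exact and4_parallel_nonpos hq0 hq1 k₁ k₂' kS' hobne haoF (Finset.mem_insert_self _ _) hdN (Finset.erase_subset _ _)
          ((Finset.erase_subset _ _).trans (Finset.subset_insert _ _)) hY₁ hΞ₁ hY₂ hΞ₂ hm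
      -- where are the star edges?
      rcases Finset.mem_union.1 hao with hao₁ | hao₂ <;> rcases Finset.mem_union.1 hoc with hoc₁ | hoc₂
      · -- both in `E₁`
        have hao₂ : s(a, o) ∉ E₂ := Finset.disjoint_left.1 hd hao₁
        have hoc₂ : s(o, c) ∉ E₂ := Finset.disjoint_left.1 hd hoc₁
        have hN : ((E₁ ∪ E₂).erase s(a, o)).erase s(o, c) = (E₁.erase s(a, o)).erase s(o, c) ∪ E₂ := by
          rw [erase_union_of_notMem_right hao₂, erase_union_of_notMem_right hoc₂]
        rw [hN] at hmono ⊢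
        exact theta h₁ h₂ hd hcard₁ g₁ g₂ hS hao₁ hoc₁ hob₁ h hmono
      · -- `ao ∈ E₁`, `oc ∈ E₂`
        have hao₂ : s(a, o) ∉ E₂ := Finset.disjoint_left.1 hd hao₁
        have hoc₁ : s(o, c) ∉ E₁ := Finset.disjoint_right.1 hd hoc₂
        have hN : ((E₁ ∪ E₂).erase s(a, o)).erase s(o, c) = E₁.erase s(a, o) ∪ E₂.erase s(o, c) := by
          rw [erase_union_of_notMem_right hao₂, erase_union_of_notMem_left (fun h' => hoc₁ (Finset.mem_of_mem_erase h'))]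
        rw [hN] at hmono ⊢
        exact par h₁ h₂ hd g₁ g₂ hS hao₁ hoc₂ hob₁ hob₂ h hmono
      · -- `ao ∈ E₂`, `oc ∈ E₁`
        have hao₁ : s(a, o) ∉ E₁ := Finset.disjoint_right.1 hd hao₂
        have hoc₂ : s(o, c) ∉ E₂ := Finset.disjoint_left.1 hd hoc₁
        have hN : ((E₁ ∪ E₂).erase s(a, o)).erase s(o, c) = E₂.erase s(a, o) ∪ E₁.erase s(o, c) := by
          rw [erase_union_of_notMem_left hao₁, erase_union_of_notMem_right (fun h' => hoc₂ (Finset.mem_of_mem_erase h')),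
            Finset.union_comm]
        rw [hN] at hmono ⊢
        exact par h₂ h₁ hd.symm g₂ g₁ hS' hao₂ hoc₁ hob₂ hob₁ h hmono
      · -- both in `E₂`
        have hao₁ : s(a, o) ∉ E₁ := Finset.disjoint_right.1 hd hao₂
        have hoc₁ : s(o, c) ∉ E₁ := Finset.disjoint_right.1 hd hoc₂
        have hN : ((E₁ ∪ E₂).erase s(a, o)).erase s(o, c) = (E₂.erase s(a, o)).erase s(o, c) ∪ E₁ := by
          rw [erase_union_of_notMem_left hao₁, erase_union_of_notMem_left hoc₁, Finset.union_comm]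
        rw [hN] at hmono ⊢
        exact theta h₂ h₁ hd.symm hcard₂ g₂ g₁ hS' hao₂ hoc₂ hob₂ (h' := h) hmono

/-- **THEOREM (`C_∞` at level 3 for the 3-star on every 2-connected series–parallel graph).**  Let `K` be a two-terminal series–parallel
network between `o` and `b` containing the distinct edges `ao`, `oc` and not containing `ob`, and `H = K ∪ {ob}` — an arbitrary 2-connected
series–parallel graph presented from its edge `ob`, `S = {ao, ob, oc} ⊆ H` an arbitrary 3-star centred at `o`.  Then for every `0 < q ≤ 1` and
every `g` increasing on the subsets of `K \ {ao, oc}` and not reading `S`: `apPsi q H 1_{S ⊆ ·} g ≤ 0`, i.e. EVERY square-free coefficient of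
`Z_H(z)² · Cov_{φ_{z,q}}(ω_{ao} ω_{ob} ω_{oc}, g)` is `≤ 0` — gen 10's Conjecture `C_∞` for the AND type on a 3-star; with file 30a (3-edge path) and
gen 17 (triangle), level 3 of `C_∞` holds for every connected 3-edge `S` on series–parallel graphs.  Proof: bridge + `and_star3_drift_nonpos_of_isTTSP`.
[cite: Grimmett2006, §3.8 Thm. (3.90) (pp. 61–62); §3.9 (pp. 63–64)] [cite: Wagner2006, Thm. 5.8(d), §5.3] -/
theorem apPsi_and_star3_nonpos_of_isTTSP {q : ℝ} (hq0 : 0 < q) (hq1 : q ≤ 1) {K : Finset (Sym2 V)} {o a b c : V}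
    (hK : IsTTSP K o b) (hao : s(a, o) ∈ K) (hoc : s(o, c) ∈ K) (hne : s(a, o) ≠ s(o, c)) (hob : s(o, b) ∉ K)
    {g : Finset (Sym2 V) → ℝ} (hg : ∀ A T : Finset (Sym2 V), T ⊆ {s(a, o), s(o, b), s(o, c)} → g (A ∪ T) = g A)
    (hmono : ∀ ⦃A B : Finset (Sym2 V)⦄, A ⊆ B → B ⊆ (K.erase s(a, o)).erase s(o, c) → g A ≤ g B) :
    apPsi q (insert s(o, b) K) (fun X => if ({s(a, o), s(o, b), s(o, c)} : Finset (Sym2 V)) ⊆ X then 1 else 0) g ≤ 0 := by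
  have hNS : Disjoint ((K.erase s(a, o)).erase s(o, c)) ({s(a, o), s(o, b), s(o, c)} : Finset (Sym2 V)) := by
    refine Finset.disjoint_left.2 fun e he heS => ?_
    simp only [Finset.mem_insert, Finset.mem_singleton] at heS
    rcases heS with rfl | rfl | rfl
    · exact Finset.notMem_erase _ _ (Finset.mem_of_mem_erase he)
    · exact hob (Finset.mem_of_mem_erase (Finset.mem_of_mem_erase he))
    · exact Finset.notMem_erase _ _ he
  rw [← erase_erase_union_star3_eq hao hoc, apPsi_andInd_eq q hNS ⟨s(a, o), Finset.mem_insert_self _ _⟩ hg]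
  have main := and_star3_drift_nonpos_of_isTTSP hq0 hq1 K.card le_rfl hK hao hoc hne hob g hmono
  linarith

end StarPath

end FK

end Summit.CriticalPhenomena.PercolationContinuityZ3.Theorems

end
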